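import Literature.MathematicalPhysics.QuantumFieldTheory.Balaban1983to89.BlockAveragingPlaquetteBound
import Literature.MathematicalPhysics.QuantumFieldTheory.Balaban1983to89.LatticeWordStokesLocal
import HarnessLib

/-!
# `Balaban1983to89.BlockAveragingPlaquetteBoundLocal` — [Balaban1985Averaging] Prop. 1 for the (0.4) averaging `blockAvg ℰp` IN LOCAL FORM:
# a coarse plaquette of `Ū` is small as soon as the fine plaquettes in the `3^d` blocks around it are small

Cell `ym3-torus` (rung R3), seat `ym3-torus-p2` gen 12; OWNER RULING g18-№3 §5 («TARGET = LOCAL [B7] Prop. 1 for `blockAvg ℰp` … needed by the END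
theorem under every design (the `χ_{k+1}` on the right of (55))»), alpha-1's spec (fleet INBOX 06:07:26Z).  The tree's
`BlockAveragingPlaquetteBound.plaqSmall_blockAvg_expMeanLogSU` is GLOBAL (`PlaqSmall a U` on the whole torus ⇒ `PlaqSmall (C·a) Ū`); the large-field
bookkeeping of [Balaban1985UV3] ((38)–(40) p.266: «Ω_k ⊃ Λ_k ⊃ Ω_{k+1} ⊃ Λ_{k+1}», the new small-field function `χ_{k+1}` lives on `Ω_{k+1}` only) needs
it for fields that are small on a REGION.

WHAT IS PROVED (elementary; the constants are the crude ones of the global file):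
* §1 letter counts versus net displacement (`neg_count_le_netDisp`, `netDisp_le_count`), the letter counts of `axisRun` ∕ `stairWord` ∕ `wordRev` ∕
  `loopWord` (**`count_loopWord_le`**: the loop word `Γ ∪ [x,x′] ∪ (−Γ′) ∪ (−c)` of (0.4) uses the letter `(κ, s)` at most `|n_κ| + [κ = μ]·L` times);
* §2 **`blockOf_walkEnd_of_count_le_loopWord`**: every site reachable from the block centre `emb c₋` with the letters of a loop word of `c = ⟨y, y+e_μ⟩`
  (the COUNT BOX of `LatticeWordStokesLocal`) lies in `B(y − e_μ) ∪ B(y) ∪ B(y + e_μ)` (standing range);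
* §3 **`dist1_loopHol_le_local`**, **`small_of_plaqSmallOn_blocks`**, **`dist1_corr_le_local`**: the (0.4) loop variables at `c` are within
  `t := (((d+2)L)²/4)·a` of `1`, the guard holds and the correction factor of `blockAvg expMeanLogSU` is within `6t` of `1`, as soon as every fine
  plaquette BASED IN those three blocks is within `a` of `1` and `t < δ_N`;
* §4–§5 **`dist1_plaqHol_avgFun_lt_local`** (nine explicit blocks), **`dist1_plaqHol_avgFun_lt_of_near`** (`ℓ^∞`-radius-1 blocks),
  **`plaqSmallOn_avgFun_of_near`** (`PlaqSmallOn` form over a set of coarse plaquettes) — [Balaban1985Averaging] PROP. 1 IN LOCAL FORM: if every fine plaquette `q` whose base block `blockOf q₋` is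
  within `ℓ^∞`-distance `1` of the corner `y = p′₋` of a coarse plaquette `p′` is within `a` of `1`, and `t < δ_N`, then
  `dist1 (Ū(∂p′)) < (L² + 6((d+2)L)²)·a` for `Ū = avgFun expMeanLogSU U` (standing range) — the axial `L × L` square (`B10Eq47AxialChi`, blocks
  `y, y+e_μ, y+e_ν, y+e_μ+e_ν`) plus the four correction factors (blocks within distance `1` of `y`).
WHAT THIS IS NOT: not the sharp printed (51); nothing about the divergence clause; `SU(N)` with the tree's `expMeanLogSU` only.  No `sorry`, no `def`.

References: T. Bałaban, CMP 98 (1985) 17–51 [Balaban1985Averaging] ((19)–(20) p.21, Prop. 1 (51) p.26); CMP 109 (1987) 249–301 [Balaban1987RG1]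
((0.3)–(0.4) pp.252–253); CMP 102 (1985) 255–275 [Balaban1985UV3] ((38)–(40) p.266).
-/

noncomputable section

open scoped BigOperators

namespace Literature.MathematicalPhysics.QuantumFieldTheory.Balaban1983to89.BlockAveragingPlaquetteBoundLocal

open T4Continuum T4ReflectionCone LatticeWordStokes LatticeWordStokesLocal BlockAveraging

/-! ## §1 Letter counts -/

section Counts

variable {d : ℕ}

/-- `netDisp w κ ≤ #{letters +e_κ in w}`. [folklore] -/
private theorem netDisp_le_count (κ : Fin d) : ∀ w : List (Letter d), netDisp w κ ≤ (w.count (κ, true) : ℤ)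
  | [] => by simp [netDisp]
  | (b, s) :: w => by
    have ih := netDisp_le_count κ w
    rw [netDisp_cons, List.count_cons]
    by_cases hb : b = κ
    · subst hb
      cases s
      · have : ((b, false) == (b, true)) = false := beq_eq_false_iff_ne.mpr (by simp)
        simp only [this, if_true, Bool.false_eq_true, if_false]
        push_cast
        linarith
      · have : ((b, true) == (b, true)) = true := beq_self_eq_true _
        simp only [this, if_true]
        push_cast
        linarith
    · have : ((b, s) == (κ, true)) = false := by
        rw [beq_eq_false_iff_ne]; intro h; exact hb (congrArg Prod.fst h)
      simp only [this, hb, if_false, Bool.false_eq_true]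
      push_cast
      linarith

/-- `−#{letters −e_κ in w} ≤ netDisp w κ`. [folklore] -/
private theorem neg_count_le_netDisp (κ : Fin d) : ∀ w : List (Letter d), -(w.count (κ, false) : ℤ) ≤ netDisp w κ
  | [] => by simp [netDisp]
  | (b, s) :: w => by
    have ih := neg_count_le_netDisp κ w
    rw [netDisp_cons, List.count_cons]
    by_cases hb : b = κ
    · subst hb
      cases s
      · have : ((b, false) == (b, false)) = true := beq_self_eq_true _
        simp only [this, if_true, Bool.false_eq_true, if_false]
        push_cast
        linarith
      · have : ((b, true) == (b, false)) = false := beq_eq_false_iff_ne.mpr (by simp)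
        simp only [this, if_true, Bool.false_eq_true, if_false]
        push_cast
        linarith
    · have : ((b, s) == (κ, false)) = false := by
        rw [beq_eq_false_iff_ne]; intro h; exact hb (congrArg Prod.fst h)
      simp only [this, hb, if_false, Bool.false_eq_true]
      push_cast
      linarith

/-- The letters of a run in direction `a` all have direction `a`: no letter `(κ, s)` with `κ ≠ a`. [folklore] -/
private theorem count_axisRun_of_ne {a κ : Fin d} (h : a ≠ κ) (k : ℤ) (s : Bool) : (axisRun a k).count (κ, s) = 0 := by
  rw [axisRun, List.count_replicate]
  have : ((a, decide (0 ≤ k)) == (κ, s)) = false := by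
    rw [beq_eq_false_iff_ne]; intro h'; exact h (congrArg Prod.fst h')
  simp [this]

/-- A run of `|k|` letters `sign(k)·e_κ` contains the letter `(κ, s)` at most `|k|` times, and not at all unless `s = sign k`. [folklore] -/
private theorem count_axisRun_le (κ : Fin d) (k : ℤ) (s : Bool) :
    (axisRun κ k).count (κ, s) ≤ if s = decide (0 ≤ k) then k.natAbs else 0 := by
  rw [axisRun, List.count_replicate]
  by_cases hs : s = decide (0 ≤ k)
  · subst hs; simp
  · have : ((κ, decide (0 ≤ k)) == (κ, s)) = false := by
      rw [beq_eq_false_iff_ne]; intro h'; exact hs (congrArg Prod.snd h').symm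
    simp [this, hs]

/-- A staircase through axes not containing `κ` has no letter in direction `κ`. [folklore] -/
private theorem count_stairRuns_of_not_mem (n : Fin d → ℤ) (κ : Fin d) (s : Bool) :
    ∀ as : List (Fin d), κ ∉ as → (stairRuns n as).count (κ, s) = 0
  | [], _ => rfl
  | a :: as, h => by
    rw [List.mem_cons, not_or] at h
    rw [stairRuns, List.count_append, count_axisRun_of_ne (Ne.symm h.1), count_stairRuns_of_not_mem n κ s as h.2]

/-- A staircase through a duplicate-free list of axes contains the letter `(κ, s)` at most `|n_κ|` times, and not at all unless `s = sign n_κ`.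
[cite: Balaban1987RG1, (0.3) p.252] -/
theorem count_stairRuns_le (n : Fin d → ℤ) (κ : Fin d) (s : Bool) :
    ∀ as : List (Fin d), as.Nodup → (stairRuns n as).count (κ, s) ≤ if s = decide (0 ≤ n κ) then (n κ).natAbs else 0
  | [], _ => by simp [stairRuns]
  | a :: as, h => by
    rw [List.nodup_cons] at h
    rw [stairRuns, List.count_append]
    by_cases ha : a = κ
    · subst ha
      rw [count_stairRuns_of_not_mem n a s as h.1, add_zero]
      exact count_axisRun_le a (n a) s
    · rw [count_axisRun_of_ne ha, zero_add]
      exact count_stairRuns_le n κ s as h.2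

/-- The staircase word `Γ^σ_{y,x}` contains the letter `(κ, s)` at most `|n_κ|` times, and not at all unless `s = sign n_κ`. [cite: Balaban1987RG1, (0.3) p.252] -/
theorem count_stairWord_le (σ : Equiv.Perm (Fin d)) (n : Fin d → ℤ) (κ : Fin d) (s : Bool) :
    (stairWord σ n).count (κ, s) ≤ if s = decide (0 ≤ n κ) then (n κ).natAbs else 0 :=
  count_stairRuns_le n κ s _ (nodup_finRange_map σ)

/-- The reversed word has the flipped letter counts: `#{(κ,s) in −w} = #{(κ,¬s) in w}`. [folklore] -/
private theorem count_wordRev (w : List (Letter d)) (κ : Fin d) (s : Bool) : (wordRev w).count (κ, s) = w.count (κ, !s) := by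
  have hinj : Function.Injective (Letter.flip (n := d)) := by
    intro l l' h
    have h2 := congrArg Letter.flip h
    simpa [Letter.flip] using h2
  have key := List.count_map_of_injective w Letter.flip hinj (κ, !s)
  simp only [Letter.flip, Bool.not_not] at key
  rw [wordRev, List.count_reverse]
  exact key

/-- **THE LETTER BUDGET OF A LOOP WORD OF (0.4)**: `Γ ∪ [x,x′] ∪ (−Γ′) ∪ (−c)` (offsets `n`, bond direction `μ`, length `L`) contains the letter
`(κ, s)` at most `|n_κ| + [μ = κ]·L` times (`Γ` contributes `|n_κ|` letters of sign `sign n_κ`, `−Γ′` as many of the opposite sign, the two runs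
`L` letters `±e_μ` each). [cite: Balaban1987RG1, (0.4) p.253] -/
theorem count_loopWord_le (L : ℕ) (μ : Fin d) (n : Fin d → ℤ) (σ σ' : Equiv.Perm (Fin d)) (κ : Fin d) (s : Bool) :
    (loopWord L μ n σ σ').count (κ, s) ≤ (n κ).natAbs + (if μ = κ then L else 0) := by
  rw [loopWord, List.count_append, List.count_append, List.count_append, count_wordRev, List.count_replicate,
    List.count_replicate]
  have hA := count_stairWord_le σ n κ s
  have hC := count_stairWord_le σ' n κ (!s)
  have hAC : (stairWord σ n).count (κ, s) + (stairWord σ' n).count (κ, !s) ≤ (n κ).natAbs := by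
    by_cases hs : s = decide (0 ≤ n κ)
    · have hns : (!s) ≠ decide (0 ≤ n κ) := by rw [← hs]; cases s <;> decide
      rw [if_pos hs] at hA; rw [if_neg hns] at hC; omega
    · rw [if_neg hs] at hA
      have : (stairWord σ' n).count (κ, !s) ≤ (n κ).natAbs := hC.trans (by split_ifs <;> omega)
      omega
  have hBD : (if ((μ, true) == (κ, s)) then L else 0) + (if ((μ, false) == (κ, s)) then L else 0) ≤ if μ = κ then L else 0 := by
    by_cases hμ : μ = κ
    · subst hμ
      rw [if_pos rfl]
      cases s
      · have h1 : ((μ, true) == (μ, false)) = false := beq_eq_false_iff_ne.mpr (by simp)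
        have h2 : ((μ, false) == (μ, false)) = true := beq_self_eq_true _
        rw [h1, h2]; simp
      · have h1 : ((μ, true) == (μ, true)) = true := beq_self_eq_true _
        have h2 : ((μ, false) == (μ, true)) = false := beq_eq_false_iff_ne.mpr (by simp)
        rw [h1, h2]; simp
    · have h1 : ((μ, true) == (κ, s)) = false := by
        rw [beq_eq_false_iff_ne]; intro h'; exact hμ (congrArg Prod.fst h')
      have h2 : ((μ, false) == (κ, s)) = false := by
        rw [beq_eq_false_iff_ne]; intro h'; exact hμ (congrArg Prod.fst h')
      simp [h1, h2, hμ]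
  omega

end Counts

/-! ## §2 The count box of a loop word lies in three blocks -/

section Geometry

variable {P : Params} {j : ℕ}

/-- `(y − e_μ) + e_μ = y` on the coarse torus. [folklore] -/
private theorem shift_unshift' (y : Site P (j + 1)) (μ : Fin P.d) : (y.unshift μ).shift μ = y := by
  funext i
  by_cases h : i = μ
  · subst h; simp [Site.shift, Site.unshift]
  · simp [Site.shift, Site.unshift, h]

/-- `emb (y − e_μ) = emb y − L e_μ` in coordinates. [folklore] -/
private theorem emb_unshift_apply (y : Site P (j + 1)) (μ ν : Fin P.d) :
    emb (y.unshift μ) ν = emb y ν - (if ν = μ then (P.L : ZMod (P.sitesPerDir j)) else 0) := by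
  have h := emb_shift_apply (y.unshift μ) μ ν
  rw [shift_unshift'] at h
  rw [h]; ring

/-- **THE COUNT BOX OF A LOOP WORD LIES IN THREE BLOCKS**: for the coarse bond `c = ⟨y, y + e_μ⟩` and any loop word of (0.4) at `c`, every site
`walkEnd (emb y) u` reached by a word `u` using each letter at most as often as the loop word lies in `B(y − e_μ)`, `B(y)` or `B(y + e_μ)`
(standing range `j + 1 ≤ m + K`; transverse displacements are at most `(L−1)/2`, longitudinal ones at most `L + (L−1)/2`). [cite: Balaban1987RG1, (0.3)-(0.4) pp.252-253] -/
theorem blockOf_walkEnd_of_count_le_loopWord (hj : j + 1 ≤ P.m + P.K) (c : PBond P (j + 1)) (i : Idx P) (u : List (Letter P.d))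
    (hu : ∀ l, u.count l ≤ (loopWord P.L c.dir (off i.1) i.2.1 i.2.2).count l) :
    blockOf (walkEnd (emb c.src) u) = c.src.unshift c.dir ∨ blockOf (walkEnd (emb c.src) u) = c.src ∨
      blockOf (walkEnd (emb c.src) u) = c.tgt := by
  have hL := AveragingRT.two_mul_half_add_one P
  -- the box: `|netDisp u κ| ≤ (L−1)/2 + [κ = μ]·L`
  have hb : ∀ κ, -((((P.L - 1) / 2 : ℕ) : ℤ) + (if c.dir = κ then (P.L : ℤ) else 0)) ≤ netDisp u κ ∧
      netDisp u κ ≤ (((P.L - 1) / 2 : ℕ) : ℤ) + (if c.dir = κ then (P.L : ℤ) else 0) := by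
    intro κ
    have hoff := off_bounds i.1 κ
    have habs : (off i.1 κ).natAbs ≤ (P.L - 1) / 2 := by omega
    have h1 := netDisp_le_count κ u
    have h2 := neg_count_le_netDisp κ u
    have b1 := (hu (κ, true)).trans (count_loopWord_le P.L c.dir (off i.1) i.2.1 i.2.2 κ true)
    have b2 := (hu (κ, false)).trans (count_loopWord_le P.L c.dir (off i.1) i.2.1 i.2.2 κ false)
    by_cases hκ : c.dir = κ
    · rw [if_pos hκ] at b1 b2
      rw [if_pos hκ]
      have b1' : ((u.count (κ, true) : ℕ) : ℤ) ≤ (((P.L - 1) / 2 : ℕ) : ℤ) + (P.L : ℤ) := by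
        have : u.count (κ, true) ≤ (P.L - 1) / 2 + P.L := b1.trans (by omega)
        exact_mod_cast this
      have b2' : ((u.count (κ, false) : ℕ) : ℤ) ≤ (((P.L - 1) / 2 : ℕ) : ℤ) + (P.L : ℤ) := by
        have : u.count (κ, false) ≤ (P.L - 1) / 2 + P.L := b2.trans (by omega)
        exact_mod_cast this
      constructor <;> linarith
    · rw [if_neg hκ] at b1 b2
      rw [if_neg hκ]
      have b1' : ((u.count (κ, true) : ℕ) : ℤ) ≤ (((P.L - 1) / 2 : ℕ) : ℤ) := by
        have : u.count (κ, true) ≤ (P.L - 1) / 2 := b1.trans (by omega)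
        exact_mod_cast this
      have b2' : ((u.count (κ, false) : ℕ) : ℤ) ≤ (((P.L - 1) / 2 : ℕ) : ℤ) := by
        have : u.count (κ, false) ≤ (P.L - 1) / 2 := b2.trans (by omega)
        exact_mod_cast this
      constructor <;> linarith
  have hcoord : ∀ ν, walkEnd (emb c.src) u ν = emb c.src ν + ((netDisp u ν : ℤ) : ZMod (P.sitesPerDir j)) :=
    fun ν => walkEnd_apply _ _ ν
  have hLz : (2 * (((P.L - 1) / 2 : ℕ) : ℤ) + 1 : ℤ) = (P.L : ℤ) := by exact_mod_cast hL
  by_cases hmid : -(((P.L - 1) / 2 : ℕ) : ℤ) ≤ netDisp u c.dir ∧ netDisp u c.dir ≤ (((P.L - 1) / 2 : ℕ) : ℤ)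
  · -- block B(y)
    right; left
    refine blockOf_eq_of_near_emb hj c.src _ (netDisp u) hcoord fun ν => ?_
    by_cases hν : c.dir = ν
    · subst hν; exact hmid
    · have := hb ν
      rw [if_neg hν, add_zero] at this
      exact this
  rw [not_and_or, not_le, not_le] at hmid
  rcases hmid with hlo | hhi
  · -- block B(y − e_μ): shift the coordinates by +L in direction μ
    left
    refine blockOf_eq_of_near_emb hj (c.src.unshift c.dir) _ (fun κ => netDisp u κ + (if κ = c.dir then (P.L : ℤ) else 0)) ?_ ?_
    · intro ν
      rw [hcoord ν, emb_unshift_apply]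
      by_cases hν : ν = c.dir
      · rw [if_pos hν, if_pos hν]; push_cast; ring
      · rw [if_neg hν, if_neg hν, add_zero, sub_zero]
    · intro ν
      by_cases hν : ν = c.dir
      · subst hν
        have := (hb c.dir).1
        rw [if_pos rfl] at this
        rw [if_pos rfl]
        constructor <;> linarith
      · rw [if_neg hν, add_zero]
        have := hb ν
        rw [if_neg (Ne.symm hν), add_zero] at this
        exact this
  · -- block B(y + e_μ): shift the coordinates by −L in direction μ
    right; right
    refine blockOf_eq_of_near_emb hj c.tgt _ (fun κ => netDisp u κ - (if κ = c.dir then (P.L : ℤ) else 0)) ?_ ?_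
    · intro ν
      rw [hcoord ν, PBond.tgt, emb_shift_apply]
      by_cases hν : ν = c.dir
      · rw [if_pos hν, if_pos hν]; push_cast; ring
      · rw [if_neg hν, if_neg hν, add_zero, sub_zero]
    · intro ν
      by_cases hν : ν = c.dir
      · subst hν
        have := (hb c.dir).2
        rw [if_pos rfl] at this
        rw [if_pos rfl]
        constructor <;> linarith
      · rw [if_neg hν, sub_zero]
        have := hb ν
        rw [if_neg (Ne.symm hν), add_zero] at this
        exact this

end Geometry

/-! ## §3 The (0.4) loop variables, the guard and the correction factor under the local hypothesis -/

section LoopWords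

variable {P : Params} {j : ℕ} {G : Type*} [GaugeGroup G]

/-- **THE (0.4) LOOP VARIABLES AT `c` ARE SMALL WHEN THE PLAQUETTES BASED IN THE THREE BLOCKS `B(c₋ − e_μ)`, `B(c₋)`, `B(c₊)` ARE**: if every
such fine plaquette is within `δ ≥ 0` of `1` then `dist1 (loopHol U c i) ≤ (((d+2)L)²/4)·δ` for every loop index `i` (standing range).
[cite: Balaban1987RG1, (0.4) p.253] -/
theorem dist1_loopHol_le_local {δ : ℝ} (hδ : 0 ≤ δ) (hj : j + 1 ≤ P.m + P.K) {U : GaugeField P j G} (c : PBond P (j + 1))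
    (hU : ∀ q : Plaq P j, (blockOf q.src = c.src.unshift c.dir ∨ blockOf q.src = c.src ∨ blockOf q.src = c.tgt) →
      dist1 (GaugeField.plaqHol U q) < δ) (i : Idx P) :
    dist1 (loopHol U c i) ≤ ((((P.d + 2) * P.L : ℕ) : ℝ) ^ 2 / 4) * δ := by
  have h := dist1_holAt_le_local U hδ (emb c.src) (loopWord P.L c.dir (off i.1) i.2.1 i.2.2)
    (fun u hu a b hab => hU ⟨walkEnd (emb c.src) u, a, b, hab⟩ (blockOf_walkEnd_of_count_le_loopWord hj c i u hu))
    (netDisp_loopWord _ _ _ _ _)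
  refine h.trans (mul_le_mul_of_nonneg_right ?_ hδ)
  have hlen : ((loopWord P.L c.dir (off i.1) i.2.1 i.2.2).length : ℝ) ≤ (((P.d + 2) * P.L : ℕ) : ℝ) := by
    exact_mod_cast length_loopWord_le c i
  have h0 : (0 : ℝ) ≤ ((loopWord P.L c.dir (off i.1) i.2.1 i.2.2).length : ℝ) := Nat.cast_nonneg _
  nlinarith

/-- **THE GUARD OF THE (0.4) AVERAGING HOLDS LOCALLY**: if the plaquettes based in `B(c₋ − e_μ) ∪ B(c₋) ∪ B(c₊)` are within `δ ≥ 0` of `1` and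
`(((d+2)L)²/4)·δ < δ_ℰ`, then `BlockAveraging.Small ℰ U c` — the total averaging `blockAvg ℰ` IS (0.4) at `c`. [cite: Balaban1987RG1, (0.4) p.253] -/
theorem small_of_plaqSmallOn_blocks (ℰ : LoopAverage G) {δ : ℝ} (hδ : 0 ≤ δ) (hj : j + 1 ≤ P.m + P.K) {U : GaugeField P j G}
    (c : PBond P (j + 1))
    (hU : ∀ q : Plaq P j, (blockOf q.src = c.src.unshift c.dir ∨ blockOf q.src = c.src ∨ blockOf q.src = c.tgt) →
      dist1 (GaugeField.plaqHol U q) < δ)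
    (hδℰ : ((((P.d + 2) * P.L : ℕ) : ℝ) ^ 2 / 4) * δ < ℰ.δ) : Small ℰ U c :=
  fun i => (dist1_loopHol_le_local hδ hj c hU i).trans_lt hδℰ

end LoopWords

section SUN

open ExpMeanLog BlockAveragingPlaquetteBound
open scoped Matrix.Norms.L2Operator

variable {n : Type*} [Fintype n] [DecidableEq n] [Nonempty n] {P : Params} {j : ℕ}

/-- **THE CORRECTION FACTOR IS CLOSE TO `1` UNDER THE LOCAL HYPOTHESIS** (`SU(N)`, `ℰ = expMeanLogSU`): if the plaquettes based in
`B(c₋ − e_μ) ∪ B(c₋) ∪ B(c₊)` are within `a ≥ 0` of `1` and `t := (((d+2)L)²/4)·a < δ_N`, then `dist1 (corr ℰp U c) ≤ 6t`.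
[cite: Balaban1985Averaging, (26)-(27) p.22; Balaban1987RG1, (0.4) p.253] -/
theorem dist1_corr_le_local {a : ℝ} (ha : 0 ≤ a) (hj : j + 1 ≤ P.m + P.K) {U : GaugeField P j (Matrix.specialUnitaryGroup n ℂ)}
    (c : PBond P (j + 1))
    (hU : ∀ q : Plaq P j, (blockOf q.src = c.src.unshift c.dir ∨ blockOf q.src = c.src ∨ blockOf q.src = c.tgt) →
      dist1 (GaugeField.plaqHol U q) < a)
    (ht : ((((P.d + 2) * P.L : ℕ) : ℝ) ^ 2 / 4) * a < deltaSU n) :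
    dist1 (corr (expMeanLogSU (n := n)) U c) ≤ 6 * (((((P.d + 2) * P.L : ℕ) : ℝ) ^ 2 / 4) * a) := by
  have hsmall : Small (expMeanLogSU (n := n)) U c := small_of_plaqSmallOn_blocks _ ha hj c hU ht
  unfold corr
  rw [if_pos hsmall]
  exact dist1_expMeanLogSU_avg_le (fun i => dist1_loopHol_le_local ha hj c hU i) ht

end SUN

/-! ## §4 The axial square and [Balaban1985Averaging] Prop. 1 in local form -/

section Square

open B10Eq47AxialChi (shiftN shiftN_succ)

variable {P : Params} {j : ℕ}

/-- Coordinates of an iterated shift: `(x + s e_μ)_κ = x_κ + [κ = μ]·s`. [folklore] -/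
private theorem shiftN_apply (x : Site P j) (μ : Fin P.d) :
    ∀ (s : ℕ) (κ : Fin P.d), shiftN x μ s κ = x κ + (if κ = μ then (s : ZMod (P.sitesPerDir j)) else 0)
  | 0, κ => by simp [shiftN]
  | s + 1, κ => by
    rw [shiftN_succ, Site.shift_apply]
    by_cases h : κ = μ
    · subst h
      rw [if_pos rfl, shiftN_apply x κ s κ, if_pos rfl, if_pos rfl]; push_cast; ring
    · rw [if_neg h, shiftN_apply x μ s κ, if_neg h, if_neg h]

/-- **THE `L × L` SQUARE OF FINE PLAQUETTES TILING A COARSE PLAQUETTE LIES IN FOUR BLOCKS**: the plaquette of `T^{(j)}` at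
`emb y + t e_ν + s e_μ` (`s, t < L`, `μ ≠ ν`) is based in `B(y)`, `B(y + e_μ)`, `B(y + e_ν)` or `B(y + e_ν + e_μ)` (standing range).
[cite: Balaban1985Averaging, (9)-(10) p.19] -/
theorem blockOf_square (hj : j + 1 ≤ P.m + P.K) (y : Site P (j + 1)) {μ ν : Fin P.d} (hμν : μ ≠ ν) {s t : ℕ} (hs : s < P.L)
    (ht : t < P.L) :
    blockOf (shiftN (shiftN (emb y) ν t) μ s) = y ∨ blockOf (shiftN (shiftN (emb y) ν t) μ s) = y.shift μ ∨
      blockOf (shiftN (shiftN (emb y) ν t) μ s) = y.shift ν ∨ blockOf (shiftN (shiftN (emb y) ν t) μ s) = (y.shift ν).shift μ := by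
  have hL := AveragingRT.two_mul_half_add_one P
  have hcoord : ∀ κ, shiftN (shiftN (emb y) ν t) μ s κ =
      emb y κ + ((((if κ = μ then (s : ℤ) else 0) + (if κ = ν then (t : ℤ) else 0) : ℤ)) : ZMod (P.sitesPerDir j)) := by
    intro κ
    rw [shiftN_apply, shiftN_apply]
    by_cases hκμ : κ = μ
    · subst hκμ; rw [if_pos rfl, if_pos rfl, if_neg hμν, if_neg hμν]; push_cast; ring
    · rw [if_neg hκμ, if_neg hκμ]
      by_cases hκν : κ = ν
      · rw [if_pos hκν, if_pos hκν]; push_cast; ring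
      · rw [if_neg hκν, if_neg hκν]; push_cast; ring
  by_cases hsh : s ≤ (P.L - 1) / 2 <;> by_cases hth : t ≤ (P.L - 1) / 2
  · -- B(y)
    left
    refine blockOf_eq_of_near_emb hj y _ (fun κ => (if κ = μ then (s : ℤ) else 0) + (if κ = ν then (t : ℤ) else 0)) hcoord ?_
    intro κ; by_cases hκμ : κ = μ
    · subst hκμ; rw [if_pos rfl, if_neg hμν]; constructor <;> omega
    · rw [if_neg hκμ]; by_cases hκν : κ = ν
      · rw [if_pos hκν]; constructor <;> omega
      · rw [if_neg hκν]; constructor <;> omega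
  · -- B(y + e_ν)
    right; right; left
    refine blockOf_eq_of_near_emb hj (y.shift ν) _
      (fun κ => (if κ = μ then (s : ℤ) else 0) + (if κ = ν then (t : ℤ) - P.L else 0)) ?_ ?_
    · intro κ
      rw [hcoord κ, emb_shift_apply]
      by_cases hκν : κ = ν
      · rw [if_pos hκν, if_pos hκν, if_pos hκν]; push_cast; ring
      · rw [if_neg hκν, if_neg hκν, if_neg hκν]; push_cast; ring
    · intro κ; by_cases hκμ : κ = μ
      · subst hκμ; rw [if_pos rfl, if_neg hμν]; constructor <;> omega
      · rw [if_neg hκμ]; by_cases hκν : κ = ν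
        · rw [if_pos hκν]; constructor <;> omega
        · rw [if_neg hκν]; constructor <;> omega
  · -- B(y + e_μ)
    right; left
    refine blockOf_eq_of_near_emb hj (y.shift μ) _
      (fun κ => (if κ = μ then (s : ℤ) - P.L else 0) + (if κ = ν then (t : ℤ) else 0)) ?_ ?_
    · intro κ
      rw [hcoord κ, emb_shift_apply]
      by_cases hκμ : κ = μ
      · rw [if_pos hκμ, if_pos hκμ, if_pos hκμ]; push_cast; ring
      · rw [if_neg hκμ, if_neg hκμ, if_neg hκμ]; push_cast; ring
    · intro κ; by_cases hκμ : κ = μ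
      · subst hκμ; rw [if_pos rfl, if_neg hμν]; constructor <;> omega
      · rw [if_neg hκμ]; by_cases hκν : κ = ν
        · rw [if_pos hκν]; constructor <;> omega
        · rw [if_neg hκν]; constructor <;> omega
  · -- B(y + e_ν + e_μ)
    right; right; right
    refine blockOf_eq_of_near_emb hj ((y.shift ν).shift μ) _
      (fun κ => (if κ = μ then (s : ℤ) - P.L else 0) + (if κ = ν then (t : ℤ) - P.L else 0)) ?_ ?_
    · intro κ
      rw [hcoord κ, emb_shift_apply, emb_shift_apply]
      by_cases hκμ : κ = μ
      · subst hκμ; rw [if_pos rfl, if_pos rfl, if_pos rfl, if_neg hμν, if_neg hμν, if_neg hμν]; push_cast; ring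
      · rw [if_neg hκμ, if_neg hκμ, if_neg hκμ]
        by_cases hκν : κ = ν
        · rw [if_pos hκν, if_pos hκν, if_pos hκν]; push_cast; ring
        · rw [if_neg hκν, if_neg hκν, if_neg hκν]; push_cast; ring
    · intro κ; by_cases hκμ : κ = μ
      · subst hκμ; rw [if_pos rfl, if_neg hμν]; constructor <;> omega
      · rw [if_neg hκμ]; by_cases hκν : κ = ν
        · rw [if_pos hκν]; constructor <;> omega
        · rw [if_neg hκν]; constructor <;> omega

end Square

section Prop1

open ExpMeanLog BlockAveragingPlaquetteBound
open B10Eq47AxialChi (shiftN)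
open scoped Matrix.Norms.L2Operator

variable {n : Type*} [Fintype n] [DecidableEq n] [Nonempty n] {P : Params} {j : ℕ}

/-- **[Balaban1985Averaging] PROP. 1 IN LOCAL FORM, one coarse plaquette** (`SU(N)`, `ℰ = expMeanLogSU`, standing range `j + 1 ≤ m + K`): let
`p′ = ⟨y, μ, ν⟩` be a plaquette of `T^{(j+1)}` and suppose every fine plaquette `q` whose base block `blockOf q₋` is one of the nine coarse sites
`y, y ± e_μ, y ± e_ν, y + e_μ + e_ν, y + e_ν + e_μ, y + e_μ − e_ν, y + e_ν − e_μ` is within `a ≥ 0` of `1`, with `(((d+2)L)²/4)·a < δ_N`.  Then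
`dist1 (Ū(∂p′)) < (L² + 6((d+2)L)²)·a` for `Ū = avgFun expMeanLogSU U`: the axial `L × L` square costs `< L²·a` (`B10Eq47AxialChi.dist1_plaqHol_axialAvg_le`,
blocks `y, y+e_μ, y+e_ν, y+e_ν+e_μ`) and each of the four correction factors `≤ 6t` (§3, blocks `c₋ − e, c₋, c₊` of the four bonds of `p′`).
[cite: Balaban1985Averaging, Prop. 1 (51) p.26; Balaban1987RG1, (0.4) p.253] -/
theorem dist1_plaqHol_avgFun_lt_local (hj : j + 1 ≤ P.m + P.K) {a : ℝ} (ha : 0 ≤ a)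
    {U : GaugeField P j (Matrix.specialUnitaryGroup n ℂ)} (p : Plaq P (j + 1))
    (hU : ∀ q : Plaq P j, blockOf q.src ∈ [p.src, p.src.shift p.μ, p.src.unshift p.μ, p.src.shift p.ν, p.src.unshift p.ν,
        (p.src.shift p.μ).shift p.ν, (p.src.shift p.ν).shift p.μ, (p.src.shift p.μ).unshift p.ν, (p.src.shift p.ν).unshift p.μ] →
      dist1 (GaugeField.plaqHol U q) < a)
    (ht : ((((P.d + 2) * P.L : ℕ) : ℝ) ^ 2 / 4) * a < deltaSU n) :
    dist1 (GaugeField.plaqHol (avgFun (expMeanLogSU (n := n)) U) p) <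
      ((P.L : ℝ) ^ 2 + 6 * (((P.d + 2) * P.L : ℕ) : ℝ) ^ 2) * a := by
  have hμν : p.μ ≠ p.ν := ne_of_lt p.hμν
  -- the axial square
  have hL : (Finset.range P.L).Nonempty := Finset.nonempty_range_iff.mpr (ne_of_gt P.L_pos)
  have hax : dist1 (GaugeField.plaqHol (AveragingRT.axialAvg U) p) < (P.L : ℝ) ^ 2 * a := by
    refine (B10Eq47AxialChi.dist1_plaqHol_axialAvg_le hj U p).trans_lt ?_
    calc ∑ t ∈ Finset.range P.L, ∑ s ∈ Finset.range P.L,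
            dist1 (GaugeField.plaqHol U ⟨shiftN (shiftN (emb p.src) p.ν t) p.μ s, p.μ, p.ν, p.hμν⟩)
        < ∑ _t ∈ Finset.range P.L, ∑ _s ∈ Finset.range P.L, a :=
          Finset.sum_lt_sum_of_nonempty hL fun t htL => Finset.sum_lt_sum_of_nonempty hL fun s hsL => hU _ (by
            have hb := blockOf_square hj p.src hμν (Finset.mem_range.mp hsL) (Finset.mem_range.mp htL)
            rcases hb with h | h | h | h <;> simp [h])
      _ = (P.L : ℝ) ^ 2 * a := by simp [Finset.sum_const, Finset.card_range]; ring
  -- the four correction factors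
  have hshμ : (p.src.shift p.μ).unshift p.μ = p.src := by
    funext i; by_cases h : i = p.μ
    · subst h; simp [Site.shift, Site.unshift]
    · simp [Site.shift, Site.unshift, h]
  have hshν : (p.src.shift p.ν).unshift p.ν = p.src := by
    funext i; by_cases h : i = p.ν
    · subst h; simp [Site.shift, Site.unshift]
    · simp [Site.shift, Site.unshift, h]
  have h1 := dist1_corr_le_local (n := n) ha hj ⟨p.src, p.μ⟩ (fun q hq => hU q (by
    simp only [PBond.tgt] at hq; rcases hq with h | h | h <;> simp [h])) ht
  have h2 := dist1_corr_le_local (n := n) ha hj ⟨p.src.shift p.μ, p.ν⟩ (fun q hq => hU q (by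
    simp only [PBond.tgt] at hq; rcases hq with h | h | h <;> simp [h])) ht
  have h3 := dist1_corr_le_local (n := n) ha hj ⟨p.src.shift p.ν, p.μ⟩ (fun q hq => hU q (by
    simp only [PBond.tgt] at hq; rcases hq with h | h | h <;> simp [h])) ht
  have h4 := dist1_corr_le_local (n := n) ha hj ⟨p.src, p.ν⟩ (fun q hq => hU q (by
    simp only [PBond.tgt] at hq; rcases hq with h | h | h <;> simp [h])) ht
  have hins := dist1_plaquette_with_corr_le
    (corr (expMeanLogSU (n := n)) U ⟨p.src, p.μ⟩) (AveragingRT.axialAvg U ⟨p.src, p.μ⟩)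
    (corr (expMeanLogSU (n := n)) U ⟨p.src.shift p.μ, p.ν⟩) (AveragingRT.axialAvg U ⟨p.src.shift p.μ, p.ν⟩)
    (corr (expMeanLogSU (n := n)) U ⟨p.src.shift p.ν, p.μ⟩) (AveragingRT.axialAvg U ⟨p.src.shift p.ν, p.μ⟩)
    (corr (expMeanLogSU (n := n)) U ⟨p.src, p.ν⟩) (AveragingRT.axialAvg U ⟨p.src, p.ν⟩)
  have hax' : dist1 (AveragingRT.axialAvg U ⟨p.src, p.μ⟩ * AveragingRT.axialAvg U ⟨p.src.shift p.μ, p.ν⟩ *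
      (AveragingRT.axialAvg U ⟨p.src.shift p.ν, p.μ⟩)⁻¹ * (AveragingRT.axialAvg U ⟨p.src, p.ν⟩)⁻¹) < (P.L : ℝ) ^ 2 * a := hax
  show dist1 (corr _ U ⟨p.src, p.μ⟩ * AveragingRT.axialAvg U ⟨p.src, p.μ⟩ *
      (corr _ U ⟨p.src.shift p.μ, p.ν⟩ * AveragingRT.axialAvg U ⟨p.src.shift p.μ, p.ν⟩) *
      (corr _ U ⟨p.src.shift p.ν, p.μ⟩ * AveragingRT.axialAvg U ⟨p.src.shift p.ν, p.μ⟩)⁻¹ *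
      (corr _ U ⟨p.src, p.ν⟩ * AveragingRT.axialAvg U ⟨p.src, p.ν⟩)⁻¹) < _
  nlinarith

end Prop1

/-! ## §5 The same with the `ℓ^∞`-neighbourhood of radius `1` and as a `PlaqSmallOn` statement -/

section Neighbourhood

open ExpMeanLog BlockAveragingPlaquetteBound
open scoped Matrix.Norms.L2Operator

variable {P : Params} {j : ℕ}

/-- The nine coarse sites around a coarse plaquette `⟨y, μ, ν⟩` used in §4 all lie within `ℓ^∞`-distance `1` of `y` (coordinatewise `y_κ`, `y_κ ± 1`).
[folklore] -/
private theorem near_of_mem_nine (y : Site P (j + 1)) {μ ν : Fin P.d} (hμν : μ ≠ ν) {z : Site P (j + 1)}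
    (hz : z ∈ [y, y.shift μ, y.unshift μ, y.shift ν, y.unshift ν, (y.shift μ).shift ν, (y.shift ν).shift μ, (y.shift μ).unshift ν,
      (y.shift ν).unshift μ]) :
    ∀ κ, z κ = y κ ∨ z κ = y κ + 1 ∨ z κ = y κ - 1 := by
  intro κ
  simp only [List.mem_cons, List.mem_nil_iff, or_false] at hz
  rcases hz with rfl | rfl | rfl | rfl | rfl | rfl | rfl | rfl | rfl <;>
    by_cases hκμ : κ = μ <;> by_cases hκν : κ = ν <;>
    simp_all [Site.shift_apply, Site.unshift_apply]

variable {n : Type*} [Fintype n] [DecidableEq n] [Nonempty n]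

/-- **[Balaban1985Averaging] PROP. 1 IN LOCAL FORM, `ℓ^∞`-neighbourhood version**: if every fine plaquette whose base block is within `ℓ^∞`-distance `1`
of the corner `y` of the coarse plaquette `p′` (coordinatewise `blockOf q₋ κ ∈ {y_κ, y_κ + 1, y_κ − 1}`) is within `a ≥ 0` of `1` and
`(((d+2)L)²/4)·a < δ_N`, then `dist1 (Ū(∂p′)) < (L² + 6((d+2)L)²)·a` (`Ū = avgFun expMeanLogSU U`, standing range).
[cite: Balaban1985Averaging, Prop. 1 (51) p.26; Balaban1987RG1, (0.4) p.253] -/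
theorem dist1_plaqHol_avgFun_lt_of_near (hj : j + 1 ≤ P.m + P.K) {a : ℝ} (ha : 0 ≤ a)
    {U : GaugeField P j (Matrix.specialUnitaryGroup n ℂ)} (p : Plaq P (j + 1))
    (hU : ∀ q : Plaq P j, (∀ κ, blockOf q.src κ = p.src κ ∨ blockOf q.src κ = p.src κ + 1 ∨ blockOf q.src κ = p.src κ - 1) →
      dist1 (GaugeField.plaqHol U q) < a)
    (ht : ((((P.d + 2) * P.L : ℕ) : ℝ) ^ 2 / 4) * a < deltaSU n) :
    dist1 (GaugeField.plaqHol (avgFun (expMeanLogSU (n := n)) U) p) <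
      ((P.L : ℝ) ^ 2 + 6 * (((P.d + 2) * P.L : ℕ) : ℝ) ^ 2) * a :=
  dist1_plaqHol_avgFun_lt_local hj ha p (fun q hq => hU q (near_of_mem_nine p.src (ne_of_lt p.hμν) hq)) ht

/-- **[Balaban1985Averaging] PROP. 1 IN LOCAL FORM, as a `PlaqSmallOn` statement**: smallness (`< a`) of the fine plaquettes based in the blocks at
`ℓ^∞`-distance `≤ 1` from the corners of a set `S′` of coarse plaquettes gives smallness (`< (L² + 6((d+2)L)²)·a`) of `Ū` on `S′`
(`(((d+2)L)²/4)·a < δ_N`, standing range) — the form in which the large-field bookkeeping of [Balaban1985UV3] (39)–(40) consumes it (`Ω_{k+1}` inside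
`Ω_k` with a collar of at least one block). [cite: Balaban1985Averaging, Prop. 1 (51) p.26; Balaban1985UV3, (39)-(40) p.266] -/
theorem plaqSmallOn_avgFun_of_near (hj : j + 1 ≤ P.m + P.K) {a : ℝ} (ha : 0 ≤ a)
    {U : GaugeField P j (Matrix.specialUnitaryGroup n ℂ)} (S' : Set (Plaq P (j + 1)))
    (hU : PlaqSmallOn {q : Plaq P j | ∃ p ∈ S', ∀ κ, blockOf q.src κ = p.src κ ∨ blockOf q.src κ = p.src κ + 1 ∨
        blockOf q.src κ = p.src κ - 1} a U)
    (ht : ((((P.d + 2) * P.L : ℕ) : ℝ) ^ 2 / 4) * a < deltaSU n) :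
    PlaqSmallOn S' (((P.L : ℝ) ^ 2 + 6 * (((P.d + 2) * P.L : ℕ) : ℝ) ^ 2) * a)
      ((blockAvg (expMeanLogSU (n := n))).avg U) :=
  fun p hp => dist1_plaqHol_avgFun_lt_of_near hj ha p (fun q hq => hU q ⟨p, hp, hq⟩) ht

end Neighbourhood

end Literature.MathematicalPhysics.QuantumFieldTheory.Balaban1983to89.BlockAveragingPlaquetteBoundLocal

end
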